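import Summits.BirchSwinnertonDyer.Rank1Residual.X11b.BDPRouteOpenInputFieldEndState
import HarnessLib

/-!
# Class X11b, route p2: the per-field records AT THE GIVEN FIELD — Hoffstein–Luo is a supplier of
# the admissible field, not an input of the records (cell `b2b-bsdres`, sub-cell `multr1-p2`, gen 28;
# file 1)

HONEST FRAMING (cell `b2b-bsdres`, run/shared/lean/b2b/bsd-rank1-residual/, verbatim in every
file): the goal of the cell is to DELETE the COMBINATION-SHAPED residual classes of the
Birch–Swinnerton-Dyer formula for ALL analytic-rank `≤ 1` elliptic curves over `ℚ` — "full BSD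
formula for every rank `≤ 1` curve in class `C`" assembled STRICTLY from published theorems — so
that the rank-`≤ 1` remainder becomes exactly the CONSTRUCTION-SHAPED classes, which are TYPED
(missing-input `Prop`s), NOT attempted. This is not "finishing BSD". Sub-cell `multr1-p2` is a
RESEARCH ROUTE on class X11b (`ClassX11b W p := r_an = 1 ∧ p ≠ 2 ∧ mult(p) ∧ irr(p)`); no claim
beyond the stated class and loci; X11b's label does not change; NOTHING is booked by this file.

THEOREMS ONLY (no definition, no named fact, no `sorry`).

## Why

Gen 27 moved THE open statement of route p2 to its weakest position in the datum direction: the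
records ask (2.4)∃♭ over ONE admissible Heegner field `K` of the pair (`d_K` odd, `p ∤ d_K`,
`p ∤ w_K`, every `ℓ ∣ N_E` split, `L(E^{d_K},1) ≠ 0`). But every gen-27 per-field record on the
Locus (`(ram) ∧ p ∤ ∏_ℓ c_ℓ(E)`) still carries the binder `hHL` (Hoffstein–Luo 1997): its
Euler-system half is the class theorem `missingUpperBoundAt_of_classX11b_of_ram_of_not_dvd`, which
CHOOSES a Heegner field of its own by Hoffstein–Luo before running Kolyvagin. When the field is
GIVEN, that choice is idle: Kolyvagin 1990 Thm. A AT THE GIVEN FIELD, Gross–Zagier at the given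
field and Skinner 2016 Thm. C for the twist `E^{d_K}` give the Euler-system half at once
(`halves_of_heegnerData_of_odd … .2`, gen 6, with the Manin-good datum of Mazur's Cor. 4.1). This
file records the per-field statements WITHOUT `hHL`: Hoffstein–Luo then enters route p2 ONLY as the
SUPPLIER of an admissible field (`exists_admissibleField_splitAt`, gen 27 file 2), never as an
input of a record that is handed its field.

## What this file proves

* `missingUpperBoundAt_of_ram_of_not_dvd_atGivenField` — EVERY ODD PRIME: for `(E,p)` with
  `r_an = 1`, `p` odd multiplicative, `E[p]` irreducible, a (ram) prime and `p ∤ ∏_ℓ c_ℓ(E)`, and ONE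
  admissible field `K`: `ord_p #Ш(E) ≤ ord_p #Ш(E)_an` from Gross–Zagier, Kolyvagin (finiteness and
  Thm. A over `K`), Skinner 2016 Thm. C, GZK over `ℚ`, modularity, Mazur 1978 Cor. 4.1 — NO
  Hoffstein–Luo, NO Néron-scaling binder.
* `P2.bsdp_of_locus_of_openInputAtGivenField` — A1 over one field, `hHL`-free twin of gen 27's
  `P2.bsdp_of_locus_of_openInputAtField`.
* `P2.openInputOnTreeAtGivenField_iff_bsdp_of_locus` — TIGHTNESS over one field, `hHL`-free: on the
  Locus, given the PUB-shaped control identity, the input over ANY admissible field ⟺ `BSD(E,p)`.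
* `P2.openInputOnTreeAtGivenField_iff_openInputOnTreeAt_of_locus` — one field ⟺ every field on
  the Locus, `hHL`-free.
* File 2 (`BDPRouteOpenInputFieldGivenRecord`) re-derives the semistable end state over one field
  and the end-state class record over one field per pair without `hHL` (on a Locus pair the field
  handed in by (T1″) serves BOTH halves).

Net effect on the binder lists of record (files 1–2): the published inputs of the per-field records are route
p2's (GZ, Kolyvagin, Kolyvagin 1990 Thm. A, Skinner 2016 Thm. C, GZK, modularity, Mazur, BDMTV,
`h32`) + the lever's + the cited PT/EP — Hoffstein–Luo 1997 appears ONLY in the `…_prescribedFields`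
suppliers (unchanged, gen 27). CONDITIONAL on the typed inputs exactly as in gen 27; nothing
booked; labels UNCHANGED; X11b stays CONSTRUCTION-SHAPED.

## References

* [McCallumLMS1991] W. G. McCallum, Kolyvagin's work on Shafarevich–Tate groups, LMS LN 153 (1991),
  §1 Theorem, p. 296. * [Skinner2016PacificMC] Thm. C (§1). * [Mazur1978] Cor. 4.1.
* [Castella2018] Thms. 2.3, 3.1, 3.2, §5. * [Castella2018Erratum] (2.4).
* [Disegni2020] Thm. 1, (∗). * [Wuthrich2014] Thm. 3, Prop. 21. * [SteinWuthrich2013] Thm. 6.1.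
* [BalakrishnanEtAl2019] Thm. 1.2. * [Miller2011LMS] Def. 1.1.
-/

noncomputable section

open scoped Classical NumberField

open WeierstrassCurve NumberField IsDedekindDomain Field
open Literature.NumberTheory.EllipticCurves Literature.NumberTheory.EllipticCurves.GreenbergSelmer
  Literature.NumberTheory.EllipticCurves.ModularForms
  Literature.NumberTheory.EllipticCurves.Rank1Residual
  Literature.NumberTheory.EllipticCurves.Rank1Residual.Typed
  Literature.NumberTheory.EllipticCurves.Wuthrich2014
  Literature.NumberTheory.EllipticCurves.Castella2018
  Literature.NumberTheory.EllipticCurves.SteinWuthrich2013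
  Literature.NumberTheory.EllipticCurves.Disegni2020
  Literature.NumberTheory.EllipticCurves.Skinner2016
  Literature.NumberTheory.EllipticCurves.BalakrishnanEtAl2019
  Literature.NumberTheory.EllipticCurves.KrizLi2019
  Literature.NumberTheory.QuadraticFields.Quadratic
  Literature.NumberTheory.Automorphic
  Literature.NumberTheory.GaloisRepresentations Literature.NumberTheory.GaloisCohomology

namespace Summit.BirchSwinnertonDyer.Rank1Residual.X11b

/-! ### §1 The Euler-system half on the Locus AT THE GIVEN FIELD — every odd prime, no Hoffstein–Luo -/

section GivenField

variable (W : WeierstrassCurve ℚ) [W.IsElliptic] [W.IsGloballyMinimal] (p : ℕ) [Fact p.Prime]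
  {K : Type} [Field K] [NumberField K]

/-- **The Euler-system half on `(ram) ∧ p ∤ ∏_ℓ c_ℓ(E)` AT THE GIVEN ADMISSIBLE FIELD — every odd
prime, no Hoffstein–Luo.** For `E/ℚ` with `ord_{s=1} L(E,s) = 1`, `p` odd of multiplicative
reduction, `E[p]` irreducible, a (ram) prime, `p ∤ ∏_ℓ c_ℓ(E)`, and an imaginary quadratic `K` with
`d_K` odd, `p ∤ d_K`, `p ∤ w_K`, every `ℓ ∣ N_E` split and `L(E^{d_K},1) ≠ 0`:
`ord_p #Ш(E) ≤ ord_p #Ш(E)_an` (`Typed.MissingUpperBoundAt W p`). Proof: Mazur's Manin-good datum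
over `K` (`exists_maninDatum_of_odd`), a minimal model of the twist, Kolyvagin 1990 Thm. A over `K`
(`ρ̄` onto from irr + (ram)), and `halves_of_heegnerData_of_odd … .2`. The class theorem
`missingUpperBoundAt_of_classX11b_of_ram_of_not_dvd` is this one at a Hoffstein–Luo field.
UNCONDITIONAL (published named facts only); nothing booked.
[cite: McCallumLMS1991, §1 Theorem (Kolyvagin), p. 296] [cite: Skinner2016PacificMC, Thm. C (§1) and footnote 1]
[cite: JetchevSkinnerWan2017, §7.4.2 (p. 31)] [cite: Mazur1978, Cor. 4.1] [cite: Miller2011LMS, Def. 1.1] -/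
theorem missingUpperBoundAt_of_ram_of_not_dvd_atGivenField
    (hGZ : ∀ (N : ℕ) [NeZero N] (W : WeierstrassCurve ℚ) (K : Type) [Field K] [NumberField K],
      gross_zagier N W K)
    (hKo : ∀ (N : ℕ) [NeZero N] (W : WeierstrassCurve ℚ) (K : Type) [Field K] [NumberField K],
      kolyvagin N W K)
    (hB : ∀ (N : ℕ) [NeZero N] (W : WeierstrassCurve ℚ) (K : Type) [Field K] [NumberField K],
      Kolyvagin1990_padicValNat_card_sha_le N W K)
    (hSk : Skinner2016.thmC_padicValRat_bsd_rank_zero)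
    (hGZK : rank_eq_analyticRank_of_analyticRank_le_one) (hmod : hasEntireLFunction_rat)
    (hnf : exists_isNewformOf) (hMaz : mazur_not_dvd_maninConstant_of_odd)
    -- the GIVEN admissible field
    (hK : IsImaginaryQuadratic K) (hodd : Odd (NumberField.discr K))
    (hpd : ¬ (p : ℤ) ∣ NumberField.discr K) (hμ : ¬ p ∣ Units.torsionOrder K)
    (hHN : SatisfiesHeegnerHypothesis (W.conductorNorm ℤ) K)
    (hLt : (W.quadraticTwist (NumberField.discr K : ℚ)).entireLFunction 1 ≠ 0)
    -- the pair
    (hr : W.analyticRank = 1) (hp2 : p ≠ 2) (hmult : Mult W p) (hirr : Irr W p) (hram : Ram W p)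
    (htam : ¬ p ∣ W.tamagawaProduct) : Typed.MissingUpperBoundAt W p := by
  have hp : p.Prime := Fact.out
  have hNS : integral_neronScaling_of_isGloballyMinimal :=
    integral_neronScaling_of_isGloballyMinimal_holds
  haveI : NeZero (W.conductorNorm ℤ) := ⟨(W.conductorNorm_pos_holds).ne'⟩
  -- the Manin-good parametrisation and the Heegner point over the GIVEN field
  obtain ⟨Dt, H, ι, P, hP, hc⟩ :=
    exists_maninDatum_of_odd hnf hMaz hNS W p (W.conductorNorm ℤ) K rfl hp2 hmult hirr hK hHN
  -- a globally minimal model of the twist `E^{d_K}`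
  have hD0 : (NumberField.discr K : ℚ) ≠ 0 := by exact_mod_cast NumberField.discr_ne_zero K
  haveI hEt : (W.quadraticTwist (NumberField.discr K : ℚ)).IsElliptic :=
    W.isElliptic_quadraticTwist hD0
  obtain ⟨Cd, hCd⟩ := hasGlobalMinimalModel_rat_holds (W.quadraticTwist (NumberField.discr K : ℚ))
  haveI := hCd
  -- Kolyvagin 1990 Thm. A over the given field (`ρ̄_{E,p}` onto from irr + (ram))
  have hsurj : Surj W p := surj_of_irr_of_ram W p hirr hram
  have hU : Finite (W.baseChange K).sha → ¬ IsOfFinAddOrder P →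
      padicValNat p (Nat.card (W.baseChange K).sha) ≤
        2 * padicValNat p (AddSubgroup.zmultiples P).index :=
    fun _ hnt ↦ hB _ W K hK hHN ⟨Dt, H, ι, hP⟩ hnt hp hp2 hsurj
  exact (halves_of_heegnerData_of_odd W p K Dt H ι P (hGZ _ W K) (hKo _ W K) hSk hGZK hmod hr hp2
    hmult hirr hram hK hodd hpd hHN hP hc hμ hLt
    (Cd • W.quadraticTwist (NumberField.discr K : ℚ)) Cd rfl).2 htam hU

/-- Class-X11b packaging of the previous theorem (every odd prime; the field is given).
[cite: McCallumLMS1991, §1 Theorem (Kolyvagin), p. 296] [cite: Skinner2016PacificMC, Thm. C (§1)] -/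
theorem missingUpperBoundAt_of_classX11b_of_ram_of_not_dvd_atGivenField
    (hGZ : ∀ (N : ℕ) [NeZero N] (W : WeierstrassCurve ℚ) (K : Type) [Field K] [NumberField K],
      gross_zagier N W K)
    (hKo : ∀ (N : ℕ) [NeZero N] (W : WeierstrassCurve ℚ) (K : Type) [Field K] [NumberField K],
      kolyvagin N W K)
    (hB : ∀ (N : ℕ) [NeZero N] (W : WeierstrassCurve ℚ) (K : Type) [Field K] [NumberField K],
      Kolyvagin1990_padicValNat_card_sha_le N W K)
    (hSk : Skinner2016.thmC_padicValRat_bsd_rank_zero)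
    (hGZK : rank_eq_analyticRank_of_analyticRank_le_one) (hmod : hasEntireLFunction_rat)
    (hnf : exists_isNewformOf) (hMaz : mazur_not_dvd_maninConstant_of_odd)
    (hK : IsImaginaryQuadratic K) (hodd : Odd (NumberField.discr K))
    (hpd : ¬ (p : ℤ) ∣ NumberField.discr K) (hμ : ¬ p ∣ Units.torsionOrder K)
    (hHN : SatisfiesHeegnerHypothesis (W.conductorNorm ℤ) K)
    (hLt : (W.quadraticTwist (NumberField.discr K : ℚ)).entireLFunction 1 ≠ 0)
    (hX : ClassX11b W p) (hram : Ram W p) (htam : ¬ p ∣ W.tamagawaProduct) :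
    Typed.MissingUpperBoundAt W p :=
  missingUpperBoundAt_of_ram_of_not_dvd_atGivenField W p hGZ hKo hB hSk hGZK hmod hnf hMaz hK hodd hpd
    hμ hHN hLt hX.1 hX.2.1 hX.2.2.1 hX.2.2.2 hram htam

/-! ### §2 A1 over one field and its tightness, without Hoffstein–Luo -/

/-- **A1 — ANY Locus pair, `BSD(E,p)` from published facts and THE open input over ONE admissible
field — `hHL`-free.** Both halves at the GIVEN field: lower half
`P2.missingLowerBoundAt_of_openInputAtField` (gen 27), upper half
`missingUpperBoundAt_of_classX11b_of_ram_of_not_dvd_atGivenField` (§1). Gen 27's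
`P2.bsdp_of_locus_of_openInputAtField` minus the binder `hHL`. CONDITIONAL on the input over `K`;
nothing booked. [cite: Castella2018Erratum, (2.4), Thm. 1.1 (pp. 1, 4)] [cite: Castella2018, Thms. 3.1–3.2, §5]
[cite: Skinner2016PacificMC, Thm. C (§1)] [cite: McCallumLMS1991, §1 Theorem (Kolyvagin), p. 296]
[cite: Miller2011LMS, Def. 1.1] -/
theorem P2.bsdp_of_locus_of_openInputAtGivenField
    (hGZ : ∀ (N : ℕ) [NeZero N] (W : WeierstrassCurve ℚ) (K : Type) [Field K] [NumberField K],
      gross_zagier N W K)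
    (hKo : ∀ (N : ℕ) [NeZero N] (W : WeierstrassCurve ℚ) (K : Type) [Field K] [NumberField K],
      kolyvagin N W K)
    (hB : ∀ (N : ℕ) [NeZero N] (W : WeierstrassCurve ℚ) (K : Type) [Field K] [NumberField K],
      Kolyvagin1990_padicValNat_card_sha_le N W K)
    (hSk : Skinner2016.thmC_padicValRat_bsd_rank_zero) (hWu : sha_dvd_analyticSha)
    (hGZK : rank_eq_analyticRank_of_analyticRank_le_one) (hmod : hasEntireLFunction_rat)
    (hnf : exists_isNewformOf) (hMaz : mazur_not_dvd_maninConstant_of_odd)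
    (hPT : ∀ (K : Type) [Field K] [NumberField K], poitouTate_sum_localTatePairing_eq_zero K)
    (hEP : ∀ (K : Type) [Field K] [NumberField K] (v : HeightOneSpectrum (𝓞 K)),
      localEulerPoincareCharacteristic (v.adicCompletion K))
    -- ONE admissible field
    (hK : IsImaginaryQuadratic K) (hodd : Odd (NumberField.discr K))
    (hpd : ¬ (p : ℤ) ∣ NumberField.discr K) (hμ : ¬ p ∣ Units.torsionOrder K)
    (hHN : SatisfiesHeegnerHypothesis (W.conductorNorm ℤ) K)
    (hLt : (W.quadraticTwist (NumberField.discr K : ℚ)).entireLFunction 1 ≠ 0)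
    -- THE open input, over `K`
    (hA : P2.OpenInputOnTreeAtField W p K)
    -- the pair: on the Locus
    (hX : ClassX11b W p) (hp5 : 5 ≤ p) (hram : Ram W p) (htam : ¬ p ∣ W.tamagawaProduct) :
    BSDp W p := by
  have hsurj : Surj W p := surj_of_irr_of_ram W p hX.2.2.2 hram
  refine Typed.bsdp_of_missingPPartAt W p hGZK (by rw [hX.1]) ?_
  exact Typed.missingPPartAt_of_lower_of_upper W p
    (P2.missingLowerBoundAt_of_openInputAtField W p hGZ hKo hWu hGZK hmod hnf hMaz hPT hEP hK hodd
      hpd hμ hHN hLt hA hX hp5 hsurj)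
    (missingUpperBoundAt_of_classX11b_of_ram_of_not_dvd_atGivenField W p hGZ hKo hB hSk hGZK hmod hnf
      hMaz hK hodd hpd hμ hHN hLt hX hram htam)

/-- **TIGHTNESS OVER ONE FIELD, `hHL`-free: on the Locus the input over ANY admissible field ⟺
`BSD(E,p)`**, given the published facts and the PUB-shaped control identity `P2ControlOnTreeAt W p`
(Cas18 Thm. 2.3 as an identity; used only in `⟸`). Gen 27's
`P2.openInputOnTreeAtField_iff_bsdp_of_locus` minus the binder `hHL`. CONDITIONAL bookkeeping;
nothing booked. [cite: Castella2018, Thm. 2.3 (p. 5), Thm. 3.2 (p. 9), §5 (p. 12)]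
[cite: Castella2018Erratum, (2.4) (p. 4)] [cite: Skinner2016PacificMC, Thm. C (§1)] -/
theorem P2.openInputOnTreeAtGivenField_iff_bsdp_of_locus
    (hGZ : ∀ (N : ℕ) [NeZero N] (W : WeierstrassCurve ℚ) (K : Type) [Field K] [NumberField K],
      gross_zagier N W K)
    (hKo : ∀ (N : ℕ) [NeZero N] (W : WeierstrassCurve ℚ) (K : Type) [Field K] [NumberField K],
      kolyvagin N W K)
    (hB : ∀ (N : ℕ) [NeZero N] (W : WeierstrassCurve ℚ) (K : Type) [Field K] [NumberField K],
      Kolyvagin1990_padicValNat_card_sha_le N W K)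
    (hSk : Skinner2016.thmC_padicValRat_bsd_rank_zero) (hWu : sha_dvd_analyticSha)
    (hGZK : rank_eq_analyticRank_of_analyticRank_le_one) (hmod : hasEntireLFunction_rat)
    (hnf : exists_isNewformOf) (hMaz : mazur_not_dvd_maninConstant_of_odd)
    (hPT : ∀ (K : Type) [Field K] [NumberField K], poitouTate_sum_localTatePairing_eq_zero K)
    (hEP : ∀ (K : Type) [Field K] [NumberField K] (v : HeightOneSpectrum (𝓞 K)),
      localEulerPoincareCharacteristic (v.adicCompletion K))
    (hC : P2ControlOnTreeAt W p)
    (hK : IsImaginaryQuadratic K) (hodd : Odd (NumberField.discr K))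
    (hpd : ¬ (p : ℤ) ∣ NumberField.discr K) (hμ : ¬ p ∣ Units.torsionOrder K)
    (hHN : SatisfiesHeegnerHypothesis (W.conductorNorm ℤ) K)
    (hLt : (W.quadraticTwist (NumberField.discr K : ℚ)).entireLFunction 1 ≠ 0)
    (hX : ClassX11b W p) (hp5 : 5 ≤ p) (hram : Ram W p) (htam : ¬ p ∣ W.tamagawaProduct) :
    P2.OpenInputOnTreeAtField W p K ↔ BSDp W p :=
  ⟨fun hA ↦ P2.bsdp_of_locus_of_openInputAtGivenField W p hGZ hKo hB hSk hWu hGZK hmod hnf hMaz hPT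
      hEP hK hodd hpd hμ hHN hLt hA hX hp5 hram htam,
    fun h ↦ P2.openInputOnTreeAtField_of_bsdp_of_ram W p hGZ hKo hSk hGZK hmod hC hram h K⟩

/-- **ONE FIELD ⟺ EVERY FIELD on the Locus, `hHL`-free in the `⟹` direction**: the composite open
input over ONE admissible field implies the class-wide input `P2OpenInputOnTreeAt W p` (over all
fields), given the facts and the control identity; the converse is binder bookkeeping.
CONDITIONAL bookkeeping; nothing booked. [cite: Castella2018, Thm. 2.3 (p. 5), §5 (p. 12)]
[cite: Castella2018Erratum, (2.4) (p. 4)] -/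
theorem P2.openInputOnTreeAtGivenField_iff_openInputOnTreeAt_of_locus
    (hGZ : ∀ (N : ℕ) [NeZero N] (W : WeierstrassCurve ℚ) (K : Type) [Field K] [NumberField K],
      gross_zagier N W K)
    (hKo : ∀ (N : ℕ) [NeZero N] (W : WeierstrassCurve ℚ) (K : Type) [Field K] [NumberField K],
      kolyvagin N W K)
    (hB : ∀ (N : ℕ) [NeZero N] (W : WeierstrassCurve ℚ) (K : Type) [Field K] [NumberField K],
      Kolyvagin1990_padicValNat_card_sha_le N W K)
    (hSk : Skinner2016.thmC_padicValRat_bsd_rank_zero) (hWu : sha_dvd_analyticSha)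
    (hGZK : rank_eq_analyticRank_of_analyticRank_le_one) (hmod : hasEntireLFunction_rat)
    (hnf : exists_isNewformOf) (hMaz : mazur_not_dvd_maninConstant_of_odd)
    (hPT : ∀ (K : Type) [Field K] [NumberField K], poitouTate_sum_localTatePairing_eq_zero K)
    (hEP : ∀ (K : Type) [Field K] [NumberField K] (v : HeightOneSpectrum (𝓞 K)),
      localEulerPoincareCharacteristic (v.adicCompletion K))
    (hC : P2ControlOnTreeAt W p)
    (hK : IsImaginaryQuadratic K) (hodd : Odd (NumberField.discr K))
    (hpd : ¬ (p : ℤ) ∣ NumberField.discr K) (hμ : ¬ p ∣ Units.torsionOrder K)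
    (hHN : SatisfiesHeegnerHypothesis (W.conductorNorm ℤ) K)
    (hLt : (W.quadraticTwist (NumberField.discr K : ℚ)).entireLFunction 1 ≠ 0)
    (hX : ClassX11b W p) (hp5 : 5 ≤ p) (hram : Ram W p) (htam : ¬ p ∣ W.tamagawaProduct) :
    P2.OpenInputOnTreeAtField W p K ↔ P2OpenInputOnTreeAt W p :=
  ⟨fun hA ↦ P2.openInputOnTreeAt_of_bsdp_of_ram W p hGZ hKo hSk hGZK hmod hC hram
      (P2.bsdp_of_locus_of_openInputAtGivenField W p hGZ hKo hB hSk hWu hGZK hmod hnf hMaz hPT hEP hK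
        hodd hpd hμ hHN hLt hA hX hp5 hram htam),
    fun hA ↦ P2.openInputOnTreeAtField_of_openInputOnTreeAt hA⟩

end GivenField

end Summit.BirchSwinnertonDyer.Rank1Residual.X11b

end
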